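import Summits.SmoothPoincare4.SmoothPoincare4.Theses.WeylBudget
import Literature.Topology.FourManifolds.SeamTube
import Literature.Topology.FourManifolds.BoundaryGluingData
import Literature.Geometry.Riemannian.RoundSphere
import Literature.Geometry.Lorentzian.IsometryProofs
import Mathlib.Geometry.Manifold.VectorBundle.ContMDiffSection
import Mathlib.Analysis.Calculus.BumpFunction.InnerProduct
import HarnessLib

/-!
# Helper B1a `symmetricGerm_of_involution` of the crux `CorkRegluingBudget`: the τ-symmetric germ

Crux `Summit.SmoothPoincare4.SmoothPoincare4.Theses.WeylBudget.CorkRegluingBudget` (item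
stmt-SmoothPoincare4-10831, line `registered`), registered helper B1a toward Stub B1
`stub_symmetricWeylLightMetric` (its curvature-free half).  Everything here is proved.

Let `S⁴ = C ∪_φ W` be presented by piece embeddings `jC, jW` and let `τ` be a smooth involution
of `∂C`.  Then there are a Riemannian metric `g` on `S⁴`, an open neighbourhood `U` of the seam
and `Φ : S⁴ → S⁴` which on `U` is smooth, maps `U` to itself, is an involution, is a
`g`-isometry, preserves the two sides and restricts to `τ` on the seam.  Proof: for a seam tube
`K : ∂C × (-ε, ε) ≅ {|h| < ε}` of the gluing (`BoundaryGluingData.seamTube`, Hirsch 1976, Ch. 8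
§1) the germ `Φ = K ∘ (τ × id) ∘ K⁻¹` preserves the height `h`, is an involution on the tube and
is `τ` on the seam; the metric is `g = g₀ + χ · Φ^* g₀` (`g₀` round, `χ` a bump of the height,
`= 1` on `U = {|h| < ε/3}`, supported in the tube), positive definite and smooth
(`contMDiffAt_pullbackBilin_section`, `ContMDiffOn.smul_section_of_tsupport`), and on `U`
`Φ^* g = Φ^* g₀ + (Φ ∘ Φ)^* g₀ = g` by the chain rule (`Φ ∘ Φ = id` near every point of `U`).
If `∂C = ∅`: `g₀`, `U = ∅`, `Φ = id`.

References: M. W. Hirsch, *Differential Topology*, GTM 33 (1976), Ch. 8 §1 [HirschDT1976];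
B. O'Neill, *Semi-Riemannian Geometry* (1983), Ch. 3, Def. 3.9, Lemma 3.35, p. 58 [ONeill1983].
-/

-- the prescribed namespace `Summit.<P>.<Sub>.…` duplicates `SmoothPoincare4` (P = Sub)
set_option linter.dupNamespace false

open scoped Manifold ContDiff Topology
-- Mathlib's scoped instance `Fact (finrank ℝ (EuclideanSpace ℝ (Fin n)) = n)`, feeding the
-- `[Fact (finrank ℝ V = 4 + 1)]` hypothesis of `roundMetric (n := 4) (EuclideanSpace ℝ (Fin 5))`
open scoped EuclideanSpace
open Set Function Bundle

noncomputable section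

namespace Summit.SmoothPoincare4.SmoothPoincare4.Theorems.CorkRegluingBudget

open Literature.Geometry.Lorentzian Literature.Geometry.Lorentzian.PseudoRiemannianMetric
  Literature.Geometry.Riemannian Literature.Topology.FourManifolds

universe u w

/-! ### Local smoothness of pulled-back metrics; the averaged metric `g₀ + χ Φ^* g₀` -/

section Metric

variable {E : Type*} [NormedAddCommGroup E] [NormedSpace ℝ E] {H : Type*} [TopologicalSpace H]
  {I : ModelWithCorners ℝ E H} {M : Type*} [TopologicalSpace M] [ChartedSpace H M]
  {E' : Type*} [NormedAddCommGroup E'] [NormedSpace ℝ E'] {H' : Type*} [TopologicalSpace H']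
  {I' : ModelWithCorners ℝ E' H'} {N : Type*} [TopologicalSpace N] [ChartedSpace H' N]
  {n : ℕ∞ω}

/-- **Local smoothness of the pullback of a metric.** If `g` is a `C^n` pseudo-Riemannian metric
on `TM` and `f : N → M` is `C^{n+1}` at `y₀`, then the pullback family `f^* g` is `C^n` at `y₀` as
a section of the bundle of bilinear forms on `TN` (the pointwise form of
`PseudoRiemannianMetric.contMDiff_pullbackBilin_holds`, same proof: in tangent coordinates
`f^* g = (Df)ᵀ (g ∘ f) (Df)` with `Df` of class `C^n` near `y₀`, `ContMDiffAt.mfderiv_const`).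
[cite: ONeill1983, Ch. 3, Def. 3.9 and Lemma 3.35] -/
theorem contMDiffAt_pullbackBilin_section [IsManifold I' ∞ N] [IsManifold I ∞ M]
    {f : N → M} {y₀ : N} (hf : ContMDiffAt I' I (n + 1) f y₀)
    (g : PseudoRiemannianMetric I n E (TangentSpace I : M → Type _)) :
    ContMDiffAt I' (I'.prod 𝓘(ℝ, E' →L[ℝ] E' →L[ℝ] ℝ)) n
      (fun y : N ↦ TotalSpace.mk' (E' →L[ℝ] E' →L[ℝ] ℝ)
        (E := fun y : N ↦ TangentSpace I' y →L[ℝ] TangentSpace I' y →L[ℝ] ℝ) y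
        (pullbackBilin (I := I) (I' := I') f g.val y)) y₀ := by
  rw [contMDiffAt_bilin_iff]
  refine ⟨contMDiffAt_id, ?_⟩
  set τN := trivializationAt E' (TangentSpace I' : N → Type _) y₀ with hτN
  set τM := trivializationAt E (TangentSpace I : M → Type _) (f y₀) with hτM
  -- `Φ y = τM ∘ Df_y ∘ τN⁻¹` (the derivative read in charts), `C^n` at `y₀`
  set Φ : N → E' →L[ℝ] E := inTangentCoordinates I' I id f (fun y ↦ mfderiv I' I f y) y₀ with hΦ
  have hΦs : ContMDiffAt I' 𝓘(ℝ, E' →L[ℝ] E) n Φ y₀ := ContMDiffAt.mfderiv_const hf le_rfl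
  -- `β x = τM⁻ᵀ g_x τM⁻¹` (the metric read in the chart at `f y₀`), `C^n` at `f y₀`
  set β : M → E →L[ℝ] E →L[ℝ] ℝ := fun x ↦
    (ContinuousLinearMap.precomp ℝ (τM.symmL ℝ x)).comp ((g.val x).comp (τM.symmL ℝ x)) with hβ
  have hβs : ContMDiffAt I 𝓘(ℝ, E →L[ℝ] E →L[ℝ] ℝ) n β (f y₀) :=
    ((contMDiffAt_bilin_iff (IX := I) (IB := I) (V := (TangentSpace I : M → Type _)) (b := id)
      (s := g.val) (x₀ := f y₀)).1 (g.contMDiff (f y₀))).2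
  have hf' : ContMDiffAt I' I n f y₀ := hf.of_le le_self_add
  have hβf : ContMDiffAt I' 𝓘(ℝ, E →L[ℝ] E →L[ℝ] ℝ) n (fun y ↦ β (f y)) y₀ :=
    ContMDiffAt.comp y₀ hβs hf'
  have h1 : ContMDiffAt I' 𝓘(ℝ, E' →L[ℝ] E →L[ℝ] ℝ) n (fun y ↦ (β (f y)).comp (Φ y)) y₀ :=
    ContMDiffAt.clm_comp hβf hΦs
  have h2 : ContMDiffAt I' 𝓘(ℝ, (E →L[ℝ] ℝ) →L[ℝ] (E' →L[ℝ] ℝ)) n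
      (fun y ↦ (Φ y).precomp ℝ) y₀ :=
    hΦs.clm_precomp (F₃ := ℝ)
  have hcomp : ContMDiffAt I' 𝓘(ℝ, E' →L[ℝ] E' →L[ℝ] ℝ) n
      (fun y ↦ ((Φ y).precomp ℝ).comp ((β (f y)).comp (Φ y))) y₀ :=
    ContMDiffAt.clm_comp h2 h1
  -- and it agrees with the coordinate expression of `f^* g` near `y₀`
  refine hcomp.congr_of_eventuallyEq ?_
  have hev : ∀ᶠ y in 𝓝 y₀, f y ∈ τM.baseSet :=
    hf.continuousAt.preimage_mem_nhds
      (τM.open_baseSet.mem_nhds (FiberBundle.mem_baseSet_trivializationAt' (f y₀)))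
  filter_upwards [hev] with y hfy
  ext e e'
  have key : ∀ v : E', τM.symmL ℝ (f y) (Φ y v) = mfderiv I' I f y (τN.symmL ℝ y v) := by
    intro v
    simp only [hΦ, inTangentCoordinates, ContinuousLinearMap.inCoordinates,
      ContinuousLinearMap.coe_comp, comp_apply, id_eq]
    exact τM.symmL_continuousLinearMapAt hfy _
  simp only [ContinuousLinearMap.coe_comp, comp_apply, ContinuousLinearMap.precomp_apply,
    pullbackBilin_apply, hβ, key]
  rfl

variable [IsManifold I ∞ M]

/-- A Riemannian metric is positive semidefinite: `0 ≤ g (u, u)`. [folklore] -/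
theorem nonneg_of_isRiemannian {g : PseudoRiemannianMetric I n E (TangentSpace I : M → Type _)}
    (hg : g.IsRiemannian) (x : M) (u : TangentSpace I x) : 0 ≤ g.val x u u := by
  by_cases hu : u = 0
  · subst hu
    simp
  · exact (hg x u hu).le

-- the instance search `∀ x, Module ℝ (T_x M →L[ℝ] T_x M →L[ℝ] ℝ)` behind the algebra of sections of
-- the bundle of bilinear forms (`ContMDiff.add_section`, `ContMDiffOn.smul_section_of_tsupport`)
-- exceeds the default budget under the imports of the crux
set_option synthInstance.maxHeartbeats 200000 in
/-- **The averaged metric `g₀ + χ · Φ^* g₀`.**  Let `g₀` be a `C^∞` Riemannian metric on the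
boundaryless manifold `M`, `Φ : M → M` smooth on an open set `U₀`, and `χ : M → ℝ` a smooth
nonnegative function with `tsupport χ ⊆ U₀`.  Then `g = g₀ + χ · Φ^* g₀` is a `C^∞` Riemannian
metric on `M`: positive definite because `Φ^* g₀ (v, v) = g₀ (dΦ v, dΦ v) ≥ 0`, smooth because
`Φ^* g₀` is a smooth field of bilinear forms on `U₀` (`contMDiffAt_pullbackBilin_section`) and
`χ · s` is globally smooth for a section `s` smooth near `tsupport χ`
(`ContMDiffOn.smul_section_of_tsupport`).  O'Neill 1983, Ch. 3, Def. 3.9 and p. 58.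
[cite: ONeill1983, Ch. 3, Def. 3.9 and Lemma 3.35] -/
theorem exists_metric_add_smul_pullbackBilin
    (g₀ : PseudoRiemannianMetric I ∞ E (TangentSpace I : M → Type _)) (hg₀ : g₀.IsRiemannian)
    {U₀ : Set M} (hU₀ : IsOpen U₀) {Φ : M → M} (hΦ : ContMDiffOn I I ∞ Φ U₀)
    {χ : M → ℝ} (hχ : ContMDiff I 𝓘(ℝ, ℝ) ∞ χ) (hχU : tsupport χ ⊆ U₀) (hχ0 : ∀ x, 0 ≤ χ x) :
    ∃ g : PseudoRiemannianMetric I ∞ E (TangentSpace I : M → Type _),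
      g.IsRiemannian ∧
        ∀ x, g.val x = g₀.val x + χ x • pullbackBilin (I := I) (I' := I) Φ g₀.val x := by
  -- the pullback is a smooth field of bilinear forms on `U₀`
  have hpb : ContMDiffOn I (I.prod 𝓘(ℝ, E →L[ℝ] E →L[ℝ] ℝ)) ∞
      (fun y : M ↦ TotalSpace.mk' (E →L[ℝ] E →L[ℝ] ℝ)
        (E := fun y : M ↦ TangentSpace I y →L[ℝ] TangentSpace I y →L[ℝ] ℝ) y
        (pullbackBilin (I := I) (I' := I) Φ g₀.val y)) U₀ := fun y hy ↦
    (contMDiffAt_pullbackBilin_section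
      (((hΦ y hy).contMDiffAt (hU₀.mem_nhds hy)).of_le (by simp)) g₀).contMDiffWithinAt
  have hsm' : ContMDiff I (I.prod 𝓘(ℝ, E →L[ℝ] E →L[ℝ] ℝ)) ∞
      (fun y : M ↦ TotalSpace.mk' (E →L[ℝ] E →L[ℝ] ℝ)
        (E := fun y : M ↦ TangentSpace I y →L[ℝ] TangentSpace I y →L[ℝ] ℝ) y
        (χ y • pullbackBilin (I := I) (I' := I) Φ g₀.val y)) :=
    ContMDiffOn.smul_section_of_tsupport hχ.contMDiffOn hU₀ hχU hpb
  have hsm : ContMDiff I (I.prod 𝓘(ℝ, E →L[ℝ] E →L[ℝ] ℝ)) ∞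
      (fun y : M ↦ TotalSpace.mk' (E →L[ℝ] E →L[ℝ] ℝ)
        (E := fun y : M ↦ TangentSpace I y →L[ℝ] TangentSpace I y →L[ℝ] ℝ) y
        (g₀.val y + χ y • pullbackBilin (I := I) (I' := I) Φ g₀.val y)) :=
    g₀.contMDiff.add_section hsm'
  have hpb0 : ∀ (x : M) (u : TangentSpace I x),
      0 ≤ pullbackBilin (I := I) (I' := I) Φ g₀.val x u u := fun x u ↦ by
    rw [pullbackBilin_apply]
    exact nonneg_of_isRiemannian hg₀ _ _
  have hpos : ∀ (x : M) (v : TangentSpace I x), v ≠ 0 →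
      0 < (g₀.val x + χ x • pullbackBilin (I := I) (I' := I) Φ g₀.val x) v v := by
    intro x v hv
    simp only [add_apply, smul_apply, smul_eq_mul]
    exact add_pos_of_pos_of_nonneg (hg₀ x v hv) (mul_nonneg (hχ0 x) (hpb0 x v))
  refine ⟨{ val := fun x ↦ g₀.val x + χ x • pullbackBilin (I := I) (I' := I) Φ g₀.val x
            symm := fun x v w ↦ ?_
            nondegenerate := fun x v hv ↦ ?_
            contMDiff := hsm }, fun x v hv ↦ hpos x v hv, fun x ↦ rfl⟩
  · simp only [add_apply, smul_apply, smul_eq_mul]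
    rw [g₀.symm x v w, pullbackBilin_symm Φ g₀.val g₀.symm x v w]
  · by_contra h
    exact (hpos x v h).ne' (hv v)

/-- **A germ involution is an isometry of the averaged metric where the bump is `1`.**  With
`g = g₀ + χ · Φ^* g₀` as in `exists_metric_add_smul_pullbackBilin`: if `Φ` is smooth on an open
set `U₀`, maps `U₀` into itself and is an involution there, then at every `x ∈ U₀` with
`χ x = χ (Φ x) = 1` one has `(Φ^* g)_x = g_x`.  Indeed `Φ^* g = Φ^* g₀ + (χ ∘ Φ) Φ^* Φ^* g₀` and
`(Φ^* Φ^* g₀)_x = ((Φ ∘ Φ)^* g₀)_x = g₀_x` by the chain rule (`mfderiv_comp`) since `Φ ∘ Φ = id`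
near `x` (`Filter.EventuallyEq.mfderiv_eq`).  O'Neill 1983, Ch. 3, p. 58 (functoriality of the
pullback). [cite: ONeill1983, Ch. 3, Def. 3.9 and p. 58] -/
theorem pullbackBilin_eq_of_germ_involution
    (g₀ g : PseudoRiemannianMetric I ∞ E (TangentSpace I : M → Type _)) {χ : M → ℝ} {Φ : M → M}
    (hg : ∀ x, g.val x = g₀.val x + χ x • pullbackBilin (I := I) (I' := I) Φ g₀.val x)
    {U₀ : Set M} (hU₀ : IsOpen U₀) (hΦ : ContMDiffOn I I ∞ Φ U₀) (hΦU : MapsTo Φ U₀ U₀)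
    (hinv : ∀ x ∈ U₀, Φ (Φ x) = x) {x : M} (hx : x ∈ U₀) (hχx : χ x = 1) (hχΦ : χ (Φ x) = 1) :
    pullbackBilin (I := I) (I' := I) Φ g.val x = g.val x := by
  have hmd : ∀ y ∈ U₀, MDifferentiableAt I I Φ y := fun y hy ↦
    ((hΦ y hy).contMDiffAt (hU₀.mem_nhds hy)).mdifferentiableAt (by simp)
  -- `dΦ_{Φ x} ∘ dΦ_x = id`
  have hcomp : mfderiv I I (Φ ∘ Φ) x = (mfderiv I I Φ (Φ x)).comp (mfderiv I I Φ x) :=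
    mfderiv_comp x (hmd _ (hΦU hx)) (hmd x hx)
  have hev : (Φ ∘ Φ) =ᶠ[𝓝 x] id :=
    Filter.eventually_of_mem (hU₀.mem_nhds hx) fun y hy ↦ hinv y hy
  have hid : ∀ v : TangentSpace I x, mfderiv I I Φ (Φ x) (mfderiv I I Φ x v) = v := fun v ↦ by
    have h := DFunLike.congr_fun hcomp v
    rw [hev.mfderiv_eq, mfderiv_id] at h
    exact h.symm
  -- transport of the base point `Φ (Φ x) = x` together with the vectors
  have hgen : ∀ x' : M, x' = x → ∀ (v₀ w₀ : TangentSpace I x') (v₁ w₁ : TangentSpace I x),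
      v₀ = v₁ → w₀ = w₁ → g₀.val x' v₀ w₀ = g₀.val x v₁ w₁ := by
    rintro _ rfl v₀ w₀ v₁ w₁ rfl rfl
    rfl
  ext v w
  rw [pullbackBilin_apply, hg (Φ x), hg x]
  simp only [add_apply, smul_apply, smul_eq_mul, hχx, hχΦ, one_mul, pullbackBilin_apply]
  rw [hgen _ (hinv x hx) _ _ v w (hid v) (hid w), add_comm]

end Metric

/-! ### The germ `K ∘ (τ × id) ∘ K⁻¹` of a seam tube `K` -/

section Germ

variable {n : ℕ} {M N : Type u} [TopologicalSpace M] [ChartedSpace (EuclideanHalfSpace (n + 1)) M]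
  [TopologicalSpace N] [ChartedSpace (EuclideanHalfSpace (n + 1)) N]
  {bM : BoundaryData (𝓡∂ (n + 1)) M (𝓡 n)} {bN : BoundaryData (𝓡∂ (n + 1)) N (𝓡 n)}
  {φ : bM.carrier ≃ bN.carrier}
  {P : Type w} [TopologicalSpace P] [ChartedSpace (EuclideanSpace ℝ (Fin (n + 1))) P]
  {G : BoundaryGluingData bM bN φ P} (T : G.SeamTube) (τ : bM.carrier → bM.carrier)
  {Φ : P → P}

/-- **The germ preserves the height**: for the germ `Φ = K ∘ (τ × id) ∘ K⁻¹` of a seam tube `K`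
and `|h p| < ε`, `h (Φ p) = h p` (`h ∘ K = pr₂`). [folklore] -/
theorem height_germ (hΦ : ∀ p, Φ p = T.toFun (τ (T.invFun p).1, (T.invFun p).2)) {p : P}
    (hp : T.height p ∈ Ioo (-T.ε) T.ε) : T.height (Φ p) = T.height p := by
  rw [hΦ, T.invFun_snd, T.height_toFun _ _ hp]

/-- The germ maps every sub-tube `{|h| < δ}`, `δ ≤ ε`, into itself. [folklore] -/
theorem mapsTo_germ (hΦ : ∀ p, Φ p = T.toFun (τ (T.invFun p).1, (T.invFun p).2)) {δ : ℝ}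
    (hδ : δ ≤ T.ε) : MapsTo Φ (T.height ⁻¹' Ioo (-δ) δ) (T.height ⁻¹' Ioo (-δ) δ) := by
  intro p hp
  have hp' : T.height p ∈ Ioo (-T.ε) T.ε := ⟨by linarith [hp.1], by linarith [hp.2]⟩
  rw [mem_preimage, height_germ T τ hΦ hp']
  exact hp

/-- **The germ of an involution is an involution on the tube**: `Φ (Φ p) = p` for `|h p| < ε`
when `τ ∘ τ = id`. [folklore] -/
theorem germ_germ (hΦ : ∀ p, Φ p = T.toFun (τ (T.invFun p).1, (T.invFun p).2))
    (hτ : ∀ z, τ (τ z) = z) {p : P} (hp : T.height p ∈ Ioo (-T.ε) T.ε) : Φ (Φ p) = p := by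
  have h2 : (T.invFun p).2 ∈ Ioo (-T.ε) T.ε := by rw [T.invFun_snd]; exact hp
  have h1 : T.invFun (Φ p) = (τ (T.invFun p).1, (T.invFun p).2) := by
    rw [hΦ p]; exact T.invFun_toFun _ _ h2
  rw [hΦ (Φ p), h1]
  dsimp only
  rw [hτ]
  exact T.toFun_invFun p hp

/-- **The germ restricts to `τ` on the seam**: `Φ (jA (ι z)) = jA (ι (τ z))`
(`K⁻¹ (jA (ι z)) = (z, 0)`, `K (x, 0) = jA (ι x)`). [folklore] -/
theorem germ_seamPoint (hΦ : ∀ p, Φ p = T.toFun (τ (T.invFun p).1, (T.invFun p).2))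
    (z : bM.carrier) : Φ (G.jA (bM.incl z)) = G.jA (bM.incl (τ z)) := by
  rw [hΦ, T.invFun_seamPoint]
  exact T.toFun_zero (τ z)

/-- The germ preserves the first piece `jA M = {h ≥ 0}` (on the tube). [folklore] -/
theorem germ_mem_range_jA (hΦ : ∀ p, Φ p = T.toFun (τ (T.invFun p).1, (T.invFun p).2)) {p : P}
    (hp : T.height p ∈ Ioo (-T.ε) T.ε) (h : p ∈ range G.jA) : Φ p ∈ range G.jA := by
  rw [← T.height_nonneg_iff] at h ⊢
  rwa [height_germ T τ hΦ hp]

/-- The germ preserves the second piece `jB N = {h ≤ 0}` (on the tube). [folklore] -/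
theorem germ_mem_range_jB (hΦ : ∀ p, Φ p = T.toFun (τ (T.invFun p).1, (T.invFun p).2)) {p : P}
    (hp : T.height p ∈ Ioo (-T.ε) T.ε) (h : p ∈ range G.jB) : Φ p ∈ range G.jB := by
  rw [← T.height_nonpos_iff] at h ⊢
  rwa [height_germ T τ hΦ hp]

/-- **The germ of a smooth `τ` is smooth on the tube** (`K`, `τ × id` and, on the tube, `K⁻¹`
are smooth). [folklore] -/
theorem contMDiffOn_germ (hΦ : ∀ p, Φ p = T.toFun (τ (T.invFun p).1, (T.invFun p).2))
    (hτ : ContMDiff (𝓡 n) (𝓡 n) ∞ τ) :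
    ContMDiffOn (𝓡 (n + 1)) (𝓡 (n + 1)) ∞ Φ (T.height ⁻¹' Ioo (-T.ε) T.ε) := by
  have hΦ' : Φ = fun p ↦ T.toFun (τ (T.invFun p).1, (T.invFun p).2) := funext hΦ
  rw [hΦ']
  intro p hp
  have hmid : ContMDiff ((𝓡 n).prod 𝓘(ℝ, ℝ)) ((𝓡 n).prod 𝓘(ℝ, ℝ)) ∞
      fun q : bM.carrier × ℝ ↦ (τ q.1, q.2) :=
    (hτ.comp contMDiff_fst).prodMk contMDiff_snd
  exact ((T.contMDiffAt_toFun _).comp p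
    (hmid.contMDiffAt.comp p (T.contMDiffAt_invFun hp))).contMDiffWithinAt

end Germ

/-! ### The τ-symmetric germ -/

/-- **Helper B1a — the τ-symmetric germ of an involutive boundary gluing of `S⁴`.**  Let
`S⁴ = C ∪_φ W` be presented by smooth embeddings `jC, jW` (covering `S⁴`, seam relation
`jC (ι z) = jW (ι (φ z))`) and let `τ` be a smooth involution of `∂C`.  Then there are a
Riemannian metric `g` on `S⁴`, an open `U ⊇ jC (ι ∂C)` and `Φ : S⁴ → S⁴` with: `Φ` smooth on `U`,
`Φ (U) ⊆ U`, `Φ ∘ Φ = id` on `U` (so `Φ` is injective on `U`), `Φ^* g = g` on `U`, `Φ` maps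
`U ∩ jC C` into `jC C` and `U ∩ jW W` into `jW W`, and `Φ (jC (ι z)) = jC (ι (τ z))`.
Construction: `Φ = K ∘ (τ × id) ∘ K⁻¹` for a seam tube `K : ∂C × (-ε, ε) ≅ {|h| < ε}` of the
gluing (Hirsch 1976, Ch. 8 §1), `g = g_round + χ · Φ^* g_round` with `χ` a bump of the height `h`
equal to `1` on `U = {|h| < ε/3}` and supported in `{|h| ≤ 2ε/3}`; on `U`,
`Φ^* g = Φ^* g_round + (Φ ∘ Φ)^* g_round = g`.  If `∂C = ∅`: `g_round`, `U = ∅`, `Φ = id`.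
[cite: HirschDT1976, Ch. 8 §1, proof of Thm. 1.9] [cite: ONeill1983, Ch. 3, Def. 3.9 and p. 58] -/
theorem symmetricGerm_of_involution :
    ∀ (C : Type) [TopologicalSpace C] [T2Space C] [SecondCountableTopology C]
      [ChartedSpace (EuclideanHalfSpace 4) C] [IsManifold (𝓡∂ 4) ∞ C] [CompactSpace C]
      (bC : Literature.Topology.FourManifolds.BoundaryData (𝓡∂ 4) C (𝓡 3))
      (W : Type) [TopologicalSpace W] [T2Space W] [SecondCountableTopology W]
      [ChartedSpace (EuclideanHalfSpace 4) W] [IsManifold (𝓡∂ 4) ∞ W] [CompactSpace W]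
      (bW : Literature.Topology.FourManifolds.BoundaryData (𝓡∂ 4) W (𝓡 3))
      (φ : bC.carrier ≃ₘ⟮𝓡 3, 𝓡 3⟯ bW.carrier) (τ : bC.carrier ≃ₘ⟮𝓡 3, 𝓡 3⟯ bC.carrier)
      (jC : C → Metric.sphere (0 : EuclideanSpace ℝ (Fin 5)) 1)
      (jW : W → Metric.sphere (0 : EuclideanSpace ℝ (Fin 5)) 1),
      (∀ z, τ (τ z) = z) →
      Manifold.IsSmoothEmbedding (𝓡∂ 4) (𝓡 4) ∞ jC →
      Manifold.IsSmoothEmbedding (𝓡∂ 4) (𝓡 4) ∞ jW →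
      Set.range jC ∪ Set.range jW = Set.univ →
      (∀ a b, jC a = jW b ↔ ∃ z, a = bC.incl z ∧ b = bW.incl (φ z)) →
      ∃ (g : Literature.Geometry.Lorentzian.PseudoRiemannianMetric (𝓡 4) ∞ (EuclideanSpace ℝ (Fin 4))
          (TangentSpace (𝓡 4) : Metric.sphere (0 : EuclideanSpace ℝ (Fin 5)) 1 → Type _))
        (U : Set (Metric.sphere (0 : EuclideanSpace ℝ (Fin 5)) 1))
        (Φ : Metric.sphere (0 : EuclideanSpace ℝ (Fin 5)) 1 → Metric.sphere (0 : EuclideanSpace ℝ (Fin 5)) 1),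
        g.IsRiemannian ∧
          IsOpen U ∧
          (∀ z, jC (bC.incl z) ∈ U) ∧
          ContMDiffOn (𝓡 4) (𝓡 4) ∞ Φ U ∧
          Set.MapsTo Φ U U ∧
          (∀ x ∈ U, Φ (Φ x) = x) ∧
          Set.InjOn Φ U ∧
          (∀ x ∈ U, Literature.Geometry.Lorentzian.pullbackBilin (I := 𝓡 4) (I' := 𝓡 4) Φ g.val x = g.val x) ∧
          (∀ x ∈ U, x ∈ Set.range jC → Φ x ∈ Set.range jC) ∧
          (∀ x ∈ U, x ∈ Set.range jW → Φ x ∈ Set.range jW) ∧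
          (∀ z, Φ (jC (bC.incl z)) = jC (bC.incl (τ z))) := by
  intro C _ _ _ _ _ _ bC W _ _ _ _ _ _ bW φ τ jC jW hτ hjC hjW hcov hseam
  -- the round metric `g₀` on `S⁴`
  set g₀ : PseudoRiemannianMetric (𝓡 4) ∞ (EuclideanSpace ℝ (Fin 4))
      (TangentSpace (𝓡 4) : Metric.sphere (0 : EuclideanSpace ℝ (Fin 5)) 1 → Type _) :=
    roundMetric (n := 4) (EuclideanSpace ℝ (Fin 5)) with hg₀
  have hg₀R : g₀.IsRiemannian := isRiemannian_roundMetric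
  rcases isEmpty_or_nonempty bC.carrier with hE | hNE
  · -- empty seam: the round metric, `U = ∅`, `Φ = id`
    refine ⟨g₀, ∅, id, hg₀R, isOpen_empty, fun z ↦ isEmptyElim z, contMDiffOn_id,
      fun x hx ↦ hx, fun x hx ↦ hx.elim, fun x hx ↦ hx.elim, fun x hx ↦ hx.elim,
      fun x hx ↦ hx.elim, fun x hx ↦ hx.elim, fun z ↦ isEmptyElim z⟩
  -- nonempty seam: the gluing datum and a seam tube `K` with height `h` and half-width `ε`
  let G : BoundaryGluingData bC bW φ.toEquiv (Metric.sphere (0 : EuclideanSpace ℝ (Fin 5)) 1) :=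
    ⟨jC, jW, hjC, hjW, hcov, fun a b ↦ hseam a b⟩
  set T : G.SeamTube := G.seamTube with hT
  have hε : 0 < T.ε := T.ε_pos
  -- the germ `Φ = K ∘ (τ × id) ∘ K⁻¹`
  set Φ := fun p ↦ T.toFun (τ (T.invFun p).1, (T.invFun p).2) with hΦdef
  have hΦ : ∀ p, Φ p = T.toFun (τ (T.invFun p).1, (T.invFun p).2) := fun p ↦ rfl
  -- the tube `U₀ = {|h| < ε}` and the output neighbourhood `U = {|h| < ε/3}`
  set U₀ := T.height ⁻¹' Ioo (-T.ε) T.ε with hU₀def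
  set U := T.height ⁻¹' Ioo (-(T.ε / 3)) (T.ε / 3) with hUdef
  have hU₀o : IsOpen U₀ := T.isOpen_tube
  have hUo : IsOpen U := isOpen_Ioo.preimage T.contMDiff_height.continuous
  have hUU₀ : U ⊆ U₀ := fun p hp ↦ ⟨by linarith [hp.1], by linarith [hp.2]⟩
  have hΦs : ContMDiffOn (𝓡 4) (𝓡 4) ∞ Φ U₀ := contMDiffOn_germ T τ hΦ τ.contMDiff
  have hΦU₀ : MapsTo Φ U₀ U₀ := mapsTo_germ T τ hΦ le_rfl
  have hΦU : MapsTo Φ U U := mapsTo_germ T τ hΦ (by linarith)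
  have hinv : ∀ p ∈ U₀, Φ (Φ p) = p := fun p hp ↦ germ_germ T τ hΦ hτ hp
  -- the bump `χ = ρ ∘ h` of the height
  let ρ : ContDiffBump (0 : ℝ) := ⟨T.ε / 3, 2 * T.ε / 3, by positivity, by linarith⟩
  set χ := fun p ↦ ρ (T.height p) with hχdef
  have hχs : ContMDiff (𝓡 4) 𝓘(ℝ, ℝ) ∞ χ := ρ.contDiff.comp_contMDiff T.contMDiff_height
  have hχ0 : ∀ p, 0 ≤ χ p := fun p ↦ ρ.nonneg
  have hχ1 : ∀ p ∈ U, χ p = 1 := fun p hp ↦ by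
    refine ρ.one_of_mem_closedBall ?_
    rw [Metric.mem_closedBall, Real.dist_eq, sub_zero]
    exact (abs_lt.2 ⟨hp.1, hp.2⟩).le
  have hχU₀ : tsupport χ ⊆ U₀ := by
    have hcl : IsClosed (T.height ⁻¹' Metric.closedBall (0 : ℝ) (2 * T.ε / 3)) :=
      Metric.isClosed_closedBall.preimage T.contMDiff_height.continuous
    refine (closure_minimal (fun p hp ↦ ?_) hcl).trans fun p hp ↦ ?_
    · have hp' : T.height p ∈ support ρ := hp
      rw [ρ.support_eq] at hp'
      exact Metric.ball_subset_closedBall hp'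
    · have hp' : |T.height p| ≤ 2 * T.ε / 3 := by
        simpa only [mem_preimage, Metric.mem_closedBall, Real.dist_eq, sub_zero] using hp
      exact ⟨by linarith [(abs_le.1 hp').1], by linarith [(abs_le.1 hp').2]⟩
  -- the metric `g = g₀ + χ Φ^* g₀`
  obtain ⟨g, hgR, hg⟩ := exists_metric_add_smul_pullbackBilin g₀ hg₀R hU₀o hΦs hχs hχU₀ hχ0
  refine ⟨g, U, Φ, hgR, hUo, fun z ↦ ?_, hΦs.mono hUU₀, hΦU, fun x hx ↦ hinv x (hUU₀ hx),
    fun x hx y hy hxy ↦ ?_, fun x hx ↦ ?_, fun x hx hxC ↦ ?_, fun x hx hxW ↦ ?_, fun z ↦ ?_⟩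
  · -- the seam lies in `U`
    show T.height (G.jA (bC.incl z)) ∈ Ioo (-(T.ε / 3)) (T.ε / 3)
    rw [(T.height_eq_zero_iff _).2 (G.jA_incl_mem_seam z)]
    exact ⟨by linarith, by linarith⟩
  · -- injectivity on `U`
    rw [← hinv x (hUU₀ hx), ← hinv y (hUU₀ hy), hxy]
  · -- isometry on `U`
    have hχx : χ x = 1 := hχ1 x hx
    have hχΦ : χ (Φ x) = 1 := hχ1 _ (hΦU hx)
    exact pullbackBilin_eq_of_germ_involution g₀ g hg hU₀o hΦs hΦU₀ hinv (hUU₀ hx) hχx hχΦ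
  · exact germ_mem_range_jA T τ hΦ (hUU₀ hx) hxC -- the first side
  · exact germ_mem_range_jB T τ hΦ (hUU₀ hx) hxW -- the second side
  · exact germ_seamPoint T τ hΦ z -- the seam

end Summit.SmoothPoincare4.SmoothPoincare4.Theorems.CorkRegluingBudget

end
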